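import Mathlib.Logic.Equiv.Defs
import Mathlib.Data.Nat.Basic
import HarnessLib

/-!
# Howe 1989: the archimedean theta duality theorem (typed skeleton; the duality bijection extracted and proved)

R. Howe, *Transcending classical invariant theory*, J. Amer. Math. Soc. 2 (1989), no. 3, 535–552 [Howe1989], §1.
For a reductive dual pair `(G, G') ⊆ Sp = Sp_{2n}(ℝ)`, `ω` the oscillator representation of the metaplectic
two-fold cover `S̃p`, realised on a Hilbert space `𝒴` with smooth vectors `𝒴^∞` (on which `ω^∞` is defined), and
for a subgroup `Ẽ ⊆ S̃p`, Howe writes `𝓡(Ẽ)` for the infinitesimal equivalence classes of continuous irreducible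
admissible representations of `Ẽ` on locally convex spaces and `𝓡(Ẽ, ω) ⊆ 𝓡(Ẽ)` for those "realized as quotients by
`ω^∞(Ẽ)`-invariant closed subspaces of `𝒴^∞`" (p. 535).  With `𝓡(G̃ × G̃') ≅ 𝓡(G̃) × 𝓡(G̃')` via `ρ ⊗ ρ'`,
"`𝓡(G̃·G̃', ω)` defines the graph of a correspondence between certain subsets of `𝓡(G̃, ω)` and `𝓡(G̃', ω)`.  In
fact, the situation is quite precise.  THEOREM 1.  The set `𝓡(G̃·G̃', ω)` is the graph of a bijection between
(all of) `𝓡(G̃, ω)` and (all of) `𝓡(G̃', ω)`.  Moreover, an element `ρ ⊗ ρ'` of `𝓡(G̃·G̃', ω)` occurs as a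
quotient of `ω^∞` in a unique way." (p. 535, read on the AMS PDF, doi:10.1090/s0894-0347-1989-0985172-6).
Remark (b), p. 536: "If `G` or `G'` is compact, then Theorems 1 and 1A are already known and have been treated by
several authors [G, GK, H1, KV, Sa].  In fact, they then essentially amount to a version of Classical Invariant
Theory".

WHAT IS REPRODUCED: the STATEMENT of Theorem 1 as a TYPED SKELETON over a hypothesis structure `ArchThetaDatum RG RG'`
of BARE CARRIERS — the two parameter types stand for `𝓡(G̃, ω)` and `𝓡(G̃', ω)`, and one function `quotMult ρ ρ'`
records in how many ways `ρ ⊗ ρ'` occurs as a quotient of `ω^∞` (`= dim Hom_{G̃·G̃'}(ω^∞, ρ ⊗ ρ')`, so that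
`ρ ⊗ ρ' ∈ 𝓡(G̃·G̃', ω)` iff `quotMult ρ ρ' ≠ 0`).  NOTHING IS ASSERTED: a consumer takes `(h : D.HoweDualityArchimedean)`
as a hypothesis for its datum.  PROVED from the typed statement: the duality BIJECTION `θ : 𝓡(G̃, ω) ≃ 𝓡(G̃', ω)`
whose graph is `𝓡(G̃·G̃', ω)` (`HoweDualityArchimedean.theta`, `occurs_iff_eq_theta`), the converse packaging
(`of_equiv`) — so the typing "graph of a bijection between all of … and all of …" is certified to be equivalent to the
two unique-existence clauses used in the definition — and `quotMult = 1` on the graph.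

NOT here: the oscillator representation, `𝒴^∞`, the groups, Theorem 1A (p. 536: Howe's maximal quotient `ρ'₁` is a
finitely generated admissible quasisimple representation of `G̃'` with a unique irreducible quotient) — its objects have
no carrier in the tree —, the `L²`-version (Thm 6.1), the proof (§§2–5).  The non-archimedean analogue is
`Literature.RepresentationTheory.GanTakeda2016.LocalThetaDatum.HoweDuality`; the compact case of Remark (b) with its
explicit harmonic parameters is `Literature/RepresentationTheory/KashiwaraVergne1978/` and `…/Adams2007/`.

## References

* [Howe1989] R. Howe, J. Amer. Math. Soc. 2 (1989) 535–552 — §1, Theorem 1 p. 535; Theorem 1A and Remarks (a)–(d)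
  p. 536.
* [KashiwaraVergne1978], [Adams2007Theta] — the compact case (Remark (b)).
-/

namespace Literature.RepresentationTheory.Howe1989

universe u v

/-- **Carriers for Howe's archimedean duality theorem** [Howe1989, §1, p. 535]: for one reductive dual pair
`(G, G') ⊆ Sp_{2n}(ℝ)` and the oscillator representation `ω` of the metaplectic cover,
* the parameter `RG` stands for `𝓡(G̃, ω)` — infinitesimal equivalence classes of continuous irreducible admissible
  representations of `G̃` "realized as quotients by `ω^∞(G̃)`-invariant closed subspaces of `𝒴^∞`"; `RG'` likewise
  for `G̃'`;
* `quotMult ρ ρ'` — the number of ways `ρ ⊗ ρ'` "occurs as a quotient of `ω^∞`", i.e.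
  `dim Hom_{G̃·G̃'}(ω^∞, ρ ⊗ ρ')`; `ρ ⊗ ρ' ∈ 𝓡(G̃·G̃', ω)` iff this is `≠ 0`.
TYPING: only these carriers are kept; a hypothesis structure, nothing is asserted. [cite: Howe1989, §1 p. 535] -/
structure ArchThetaDatum (RG : Type u) (RG' : Type v) where
  /-- `dim Hom_{G̃·G̃'}(ω^∞, ρ ⊗ ρ')`, the number of realisations of `ρ ⊗ ρ'` as a quotient of `ω^∞` -/
  quotMult : RG → RG' → ℕ

namespace ArchThetaDatum

variable {RG : Type u} {RG' : Type v}

/-- `ρ ⊗ ρ' ∈ 𝓡(G̃·G̃', ω)`: "`ρ ⊗ ρ'` occurs as a quotient of `ω^∞`" [Howe1989, §1 p. 535], typed as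
`quotMult ρ ρ' ≠ 0`. [cite: Howe1989, §1 p. 535] -/
def Occurs (D : ArchThetaDatum RG RG') (ρ : RG) (ρ' : RG') : Prop :=
  D.quotMult ρ ρ' ≠ 0

/-- Unfolding of `Occurs`. [folklore] -/
theorem occurs_iff (D : ArchThetaDatum RG RG') (ρ : RG) (ρ' : RG') :
    D.Occurs ρ ρ' ↔ D.quotMult ρ ρ' ≠ 0 := Iff.rfl

/-- **Howe's duality theorem over `ℝ`**, AS PRINTED [Howe1989, Theorem 1, p. 535]: "The set `𝓡(G̃·G̃', ω)` is the
graph of a bijection between (all of) `𝓡(G̃, ω)` and (all of) `𝓡(G̃', ω)`.  Moreover, an element `ρ ⊗ ρ'` of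
`𝓡(G̃·G̃', ω)` occurs as a quotient of `ω^∞` in a unique way."
TYPING: "graph of a bijection between all of `RG` and all of `RG'`" = the two unique-existence clauses (for every `ρ`
exactly one `ρ'` with `ρ ⊗ ρ'` in the graph, and symmetrically) — PROVED equivalent to the existence of an
`Equiv` with that graph in `iff_exists_equiv`; "in a unique way" = `quotMult ρ ρ' ≤ 1`.  Nothing is asserted.
[cite: Howe1989, Theorem 1 p. 535] -/
def HoweDualityArchimedean (D : ArchThetaDatum RG RG') : Prop :=
  (∀ ρ : RG, ∃! ρ' : RG', D.Occurs ρ ρ') ∧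
  (∀ ρ' : RG', ∃! ρ : RG, D.Occurs ρ ρ') ∧
  ∀ (ρ : RG) (ρ' : RG'), D.quotMult ρ ρ' ≤ 1

namespace HoweDualityArchimedean

variable {D : ArchThetaDatum RG RG'}

/-- The duality map `ρ ↦ θ(ρ)`: the unique `ρ'` with `ρ ⊗ ρ' ∈ 𝓡(G̃·G̃', ω)` [Howe1989, Theorem 1 p. 535].
[cite: Howe1989, Theorem 1 p. 535] -/
noncomputable def thetaFun (h : D.HoweDualityArchimedean) (ρ : RG) : RG' :=
  Classical.choose (h.1 ρ).exists

/-- `ρ ⊗ θ(ρ)` lies in the graph `𝓡(G̃·G̃', ω)`. [cite: Howe1989, Theorem 1 p. 535] -/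
theorem occurs_thetaFun (h : D.HoweDualityArchimedean) (ρ : RG) : D.Occurs ρ (h.thetaFun ρ) :=
  Classical.choose_spec (h.1 ρ).exists

/-- The graph of the correspondence is the graph of `thetaFun`. [cite: Howe1989, Theorem 1 p. 535] -/
theorem occurs_iff_eq_thetaFun (h : D.HoweDualityArchimedean) (ρ : RG) (ρ' : RG') :
    D.Occurs ρ ρ' ↔ ρ' = h.thetaFun ρ := by
  constructor
  · intro hρ'
    exact (h.1 ρ).unique hρ' (h.occurs_thetaFun ρ)
  · rintro rfl
    exact h.occurs_thetaFun ρ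

/-- The inverse duality map `ρ' ↦ θ'(ρ')` (the unique `ρ` with `ρ ⊗ ρ'` in the graph). [cite: Howe1989, Theorem 1 p. 535] -/
noncomputable def thetaInv (h : D.HoweDualityArchimedean) (ρ' : RG') : RG :=
  Classical.choose (h.2.1 ρ').exists

/-- `θ'(ρ') ⊗ ρ'` lies in the graph `𝓡(G̃·G̃', ω)`. [cite: Howe1989, Theorem 1 p. 535] -/
theorem occurs_thetaInv (h : D.HoweDualityArchimedean) (ρ' : RG') : D.Occurs (h.thetaInv ρ') ρ' :=
  Classical.choose_spec (h.2.1 ρ').exists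

/-- **Howe duality as a bijection** `θ : 𝓡(G̃, ω) ≃ 𝓡(G̃', ω)` whose graph is `𝓡(G̃·G̃', ω)` — the content of
"the graph of a bijection between (all of) `𝓡(G̃, ω)` and (all of) `𝓡(G̃', ω)`" [Howe1989, Theorem 1 p. 535],
extracted from the typed statement. [cite: Howe1989, Theorem 1 p. 535] -/
noncomputable def theta (h : D.HoweDualityArchimedean) : RG ≃ RG' where
  toFun := h.thetaFun
  invFun := h.thetaInv
  left_inv ρ := (h.2.1 (h.thetaFun ρ)).unique (h.occurs_thetaInv _) (h.occurs_thetaFun ρ)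
  right_inv ρ' := ((h.occurs_iff_eq_thetaFun (h.thetaInv ρ') ρ').1 (h.occurs_thetaInv ρ')).symm

/-- Unfolding of the bijection `theta` to the choice function `thetaFun`. [folklore] -/
@[simp] theorem theta_apply (h : D.HoweDualityArchimedean) (ρ : RG) : h.theta ρ = h.thetaFun ρ := rfl

/-- `ρ ⊗ ρ' ∈ 𝓡(G̃·G̃', ω) ↔ ρ' = θ(ρ)`. [cite: Howe1989, Theorem 1 p. 535] -/
theorem occurs_iff_eq_theta (h : D.HoweDualityArchimedean) (ρ : RG) (ρ' : RG') :
    D.Occurs ρ ρ' ↔ ρ' = h.theta ρ :=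
  h.occurs_iff_eq_thetaFun ρ ρ'

/-- `ρ ⊗ ρ' ∈ 𝓡(G̃·G̃', ω) ↔ ρ = θ⁻¹(ρ')`. [cite: Howe1989, Theorem 1 p. 535] -/
theorem occurs_iff_eq_theta_symm (h : D.HoweDualityArchimedean) (ρ : RG) (ρ' : RG') :
    D.Occurs ρ ρ' ↔ ρ = h.theta.symm ρ' := by
  rw [h.occurs_iff_eq_theta, Equiv.eq_symm_apply, eq_comm]

/-- "occurs as a quotient of `ω^∞` in a unique way": on the graph the multiplicity is exactly `1`.
[cite: Howe1989, Theorem 1 p. 535] -/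
theorem quotMult_eq_one_of_occurs (h : D.HoweDualityArchimedean) {ρ : RG} {ρ' : RG'} (hρ : D.Occurs ρ ρ') :
    D.quotMult ρ ρ' = 1 :=
  le_antisymm (h.2.2 ρ ρ') (Nat.one_le_iff_ne_zero.mpr hρ)

/-- Off the graph the multiplicity is `0` (by definition of `Occurs`). [cite: Howe1989, §1 p. 535] -/
theorem quotMult_eq_zero_of_ne (h : D.HoweDualityArchimedean) {ρ : RG} {ρ' : RG'} (hne : ρ' ≠ h.theta ρ) :
    D.quotMult ρ ρ' = 0 := by
  by_contra h0
  exact hne ((h.occurs_iff_eq_theta ρ ρ').1 h0)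

/-- `quotMult ρ (θ ρ) = 1`. [cite: Howe1989, Theorem 1 p. 535] -/
theorem quotMult_theta (h : D.HoweDualityArchimedean) (ρ : RG) : D.quotMult ρ (h.theta ρ) = 1 :=
  h.quotMult_eq_one_of_occurs (h.occurs_thetaFun ρ)

end HoweDualityArchimedean

/-- Converse packaging: a bijection `e : RG ≃ RG'` whose graph is the occurrence relation, with multiplicity `≤ 1`
everywhere, IS Howe duality in the typed form — so the two unique-existence clauses of `HoweDualityArchimedean` say
neither more nor less than "graph of a bijection between all of `𝓡(G̃, ω)` and all of `𝓡(G̃', ω)`". [folklore] -/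
theorem HoweDualityArchimedean.of_equiv {D : ArchThetaDatum RG RG'} (e : RG ≃ RG')
    (hgraph : ∀ (ρ : RG) (ρ' : RG'), D.Occurs ρ ρ' ↔ ρ' = e ρ)
    (hmult : ∀ (ρ : RG) (ρ' : RG'), D.quotMult ρ ρ' ≤ 1) : D.HoweDualityArchimedean := by
  refine ⟨fun ρ => ⟨e ρ, (hgraph ρ _).2 rfl, fun ρ' h => (hgraph ρ ρ').1 h⟩, fun ρ' => ?_, hmult⟩
  refine ⟨e.symm ρ', (hgraph _ _).2 (e.apply_symm_apply ρ').symm, fun ρ h => ?_⟩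
  have := (hgraph ρ ρ').1 h
  rw [this, Equiv.symm_apply_apply]

/-- The typed statement is EQUIVALENT to "there is a bijection whose graph is `𝓡(G̃·G̃', ω)`, and every element of
the graph occurs in a unique way" — the printed wording of [Howe1989, Theorem 1 p. 535]. [cite: Howe1989, Theorem 1 p. 535] -/
theorem HoweDualityArchimedean.iff_exists_equiv (D : ArchThetaDatum RG RG') :
    D.HoweDualityArchimedean ↔
      (∃ e : RG ≃ RG', ∀ (ρ : RG) (ρ' : RG'), D.Occurs ρ ρ' ↔ ρ' = e ρ) ∧
        ∀ (ρ : RG) (ρ' : RG'), D.quotMult ρ ρ' ≤ 1 :=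
  ⟨fun h => ⟨⟨h.theta, h.occurs_iff_eq_theta⟩, h.2.2⟩,
    fun ⟨⟨e, he⟩, hm⟩ => HoweDualityArchimedean.of_equiv e he hm⟩

end ArchThetaDatum

end Literature.RepresentationTheory.Howe1989
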